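import Mathlib
import Literature.NumberTheory.Transcendental.RoyCriterion
import Literature.NumberTheory.Transcendental.RoyCriterionProofs
import Summits.Schanuel.Schanuel.Theorems.SoloBlindPadeContent
import HarnessLib

/-!
# The universal content of the Hermite–Padé jet lattice of `exp` is exactly `g_m`
# (Theorem U, sharpness half)

Notation as in `SoloBlindPadeContent`: `c_n(P) = taylorInt n P = (d/dw)ⁿ P(w,e^w)|_{w=0}` for
`P ∈ ℤ[X₀,X₁]`, and `g_m = ∏_{p ≤ m} p^{v_p(⌊m/p⌋!)}`.  There it is proved that
`ord₀ P(w,e^w) ≥ m ⇒ |c_m(P)|_p ≤ p^{-v_p(⌊m/p⌋!)}` for every prime `p` (so `g_m ∣ c_m(P)`).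

**Theorem U (sharpness half).** For every prime `p` and every `m` there is `P ∈ ℤ[X₀,X₁]` with
`ord₀ P(w,e^w) ≥ m` and `|c_m(P)|_p = p^{-v_p(⌊m/p⌋!)}` exactly
(`exists_taylorInt_padicNorm_eq`); consequently `p^{v_p(⌊m/p⌋!)+1} ∤ c_m(P)`
(`exists_taylorInt_not_dvd`), and an integer divides every `c_m(P)` with `ord₀ ≥ m` iff it
divides `g_m` (`forall_dvd_taylorInt_iff_dvd_padeContent`): **`g_m` is the gcd of the `m`-th jet
over the order-`≥ m` part of the lattice**, i.e. the exact universal factor in the saturation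
index of the jet map (solo paper §3d).

*Witness.* `G_p = (p−1)!·X₀ − Σ_{1≤j<p} (−1)^{j+1}((p−1)!/j)·(X₁−1)ʲ ∈ ℤ[X₀,X₁]` maps under
`Φ : X₀ ↦ log(1+z), X₁ ↦ 1+z` to `(p−1)!·Σ_{j≥p} (−1)^{j+1}zʲ/j`, of order `p` with leading
coefficient `±(p−1)!/p` of `p`-adic size `p`; then `P = (X₁−1)^{m mod p}·G_p^{⌊m/p⌋}` has
`Φ(P)` of order `m` with `|[zᵐ]Φ(P)|_p = p^{⌊m/p⌋}`, and `c_m(P) = m!·[zᵐ]Φ(P)` (leading-term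
identity of the companion file) has `|c_m(P)|_p = p^{−v_p(m!)+⌊m/p⌋} = p^{−v_p(⌊m/p⌋!)}`.
As there, `Φ = aeval ![L, 1+X]` for any `L` with the coefficients of `log(1+z)` (hypothesis
`hLc`), to stay definition-free. [this work] -/

noncomputable section

open Finset PowerSeries

namespace Summit.Schanuel.Schanuel.Theorems

open Literature.NumberTheory.Transcendental

/-! ### Orders of products and powers in `ℚ⟦z⟧` -/

/-- If `f = O(zᵃ)` and `g = O(zᵇ)` then `fg = O(z^{a+b})` with `[z^{a+b}](fg) = [zᵃ]f·[zᵇ]g`.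
[folklore] -/
theorem coeff_mul_of_coeff_lt_eq_zero {f g : ℚ⟦X⟧} {a b : ℕ} (hf : ∀ k < a, coeff k f = 0)
    (hg : ∀ k < b, coeff k g = 0) :
    (∀ k < a + b, coeff k (f * g) = 0) ∧ coeff (a + b) (f * g) = coeff a f * coeff b g := by
  refine ⟨fun k hk => ?_, ?_⟩
  · rw [coeff_mul]
    refine Finset.sum_eq_zero fun x hx => ?_
    have hx' : x.1 + x.2 = k := Finset.HasAntidiagonal.mem_antidiagonal.mp hx
    by_cases h1 : x.1 < a
    · rw [hf x.1 h1, zero_mul]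
    · rw [hg x.2 (by omega), mul_zero]
  · rw [coeff_mul, Finset.sum_eq_single (a, b)]
    · intro x hx hne
      have hx' : x.1 + x.2 = a + b := Finset.HasAntidiagonal.mem_antidiagonal.mp hx
      by_cases h1 : x.1 < a
      · rw [hf x.1 h1, zero_mul]
      · by_cases h2 : x.2 < b
        · rw [hg x.2 h2, mul_zero]
        · exact absurd (Prod.ext (by show x.1 = a; omega) (by show x.2 = b; omega)) hne
    · intro h
      exact (h (Finset.HasAntidiagonal.mem_antidiagonal.mpr rfl)).elim

/-- If `f = O(zᵃ)` then `f^q = O(z^{qa})` with `[z^{qa}](f^q) = ([zᵃ]f)^q`. [folklore] -/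
theorem coeff_pow_of_coeff_lt_eq_zero {f : ℚ⟦X⟧} {a : ℕ} (hf : ∀ k < a, coeff k f = 0) (q : ℕ) :
    (∀ k < q * a, coeff k (f ^ q) = 0) ∧ coeff (q * a) (f ^ q) = coeff a f ^ q := by
  induction q with
  | zero => simp
  | succ q ih =>
    have h := coeff_mul_of_coeff_lt_eq_zero ih.1 hf
    rw [pow_succ, pow_succ, show (q + 1) * a = q * a + a by ring]
    exact ⟨h.1, by rw [h.2, ih.2]⟩

/-! ### The witnesses `G_p` and `(X₁ − 1)^r · G_p^q` under `Φ` -/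

section Witness

variable {L : ℚ⟦X⟧}

/-- A series with the coefficients of `log(1+z)` satisfies `(1+z)·L′ = 1` and `L(0) = 0`
(the hypotheses of the companion file). [this work] -/
theorem logPair_of_coeff (hLc : ∀ j, coeff j L = ite (j = 0) (0 : ℚ) ((-1) ^ (j + 1) / (j : ℚ))) :
    (1 + X) * d⁄dX ℚ L = 1 ∧ constantCoeff L = 0 := by
  have eL : L = PowerSeries.mk fun j : ℕ => ite (j = 0) (0 : ℚ) ((-1) ^ (j + 1) / (j : ℚ)) := by
    ext j; rw [coeff_mk, hLc]
  refine ⟨by rw [eL]; exact one_add_X_mul_derivative_logSeries, ?_⟩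
  rw [← coeff_zero_eq_constantCoeff_apply, hLc, if_pos rfl]

/-- `Φ(X₁ − 1) = z`. [this work] -/
theorem aeval_logPair_X_one_sub_one (L : ℚ⟦X⟧) :
    MvPolynomial.aeval ![L, 1 + X] (MvPolynomial.X 1 - 1 : MvPolynomial (Fin 2) ℤ) = X := by
  rw [map_sub, aeval_logPair_X_one, map_one, add_sub_cancel_left]

/-- The coefficients of `Φ(G_p) = (p−1)!·L − Σ_{1≤j<p} (−1)^{j+1}((p−1)!/j) zʲ`: zero below `p`,
and `(p−1)!(−1)^{k+1}/k` at `k ≥ p`. [this work] -/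
theorem coeff_aeval_logPair_gPoly
    (hLc : ∀ j, coeff j L = ite (j = 0) (0 : ℚ) ((-1) ^ (j + 1) / (j : ℚ))) {p : ℕ}
    (hp : p.Prime) (k : ℕ) :
    coeff k (MvPolynomial.aeval ![L, 1 + X]
      (MvPolynomial.C (((p - 1).factorial : ℕ) : ℤ) * MvPolynomial.X 0 -
        ∑ j ∈ Finset.Ico 1 p, MvPolynomial.C ((-1) ^ (j + 1) * (((p - 1).factorial / j : ℕ) : ℤ))
          * (MvPolynomial.X 1 - 1) ^ j : MvPolynomial (Fin 2) ℤ)) =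
      if k < p then 0 else (((p - 1).factorial : ℕ) : ℚ) * (-1) ^ (k + 1) / (k : ℚ) := by
  have hsum : ∀ j ∈ Finset.Ico 1 p, coeff k (MvPolynomial.aeval ![L, 1 + X]
      (MvPolynomial.C ((-1) ^ (j + 1) * (((p - 1).factorial / j : ℕ) : ℤ)) *
        (MvPolynomial.X 1 - 1) ^ j : MvPolynomial (Fin 2) ℤ)) =
      if k = j then (-1) ^ (j + 1) * ((((p - 1).factorial / j : ℕ)) : ℚ) else 0 := by
    intro j _
    rw [map_mul, map_pow, aeval_logPair_C, aeval_logPair_X_one_sub_one, coeff_C_mul, coeff_X_pow]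
    simp only [Int.cast_mul, Int.cast_pow, Int.cast_neg, Int.cast_one, Int.cast_natCast]
    split_ifs <;> simp only [mul_one, mul_zero]
  rw [map_sub, map_mul, aeval_logPair_C, aeval_logPair_X_zero, map_sum, map_sub, coeff_C_mul,
    hLc k, map_sum, Finset.sum_congr rfl hsum, Finset.sum_ite_eq]
  have hp1 := hp.one_lt
  by_cases hk0 : k = 0
  · subst hk0
    simp [hp.pos]
  by_cases hkp : k < p
  · have hdvd : k ∣ (p - 1).factorial := Nat.dvd_factorial (by omega) (by omega)
    rw [if_neg hk0, if_pos (Finset.mem_Ico.mpr ⟨by omega, hkp⟩), if_pos hkp,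
      Nat.cast_div hdvd (by exact_mod_cast hk0)]
    push_cast
    ring
  · rw [if_neg hk0, if_neg (fun h => hkp (Finset.mem_Ico.mp h).2), if_neg hkp]
    push_cast
    ring

/-- The witness: for every prime `p` and every `m` there is `P ∈ ℤ[X₀,X₁]`
(namely `(X₁−1)^{m mod p}·G_p^{⌊m/p⌋}`) with `Φ(P) = c·zᵐ + O(z^{m+1})`,
`c = ((p−1)!(−1)^{p+1}/p)^{⌊m/p⌋}`. [this work] -/
theorem exists_coeff_aeval_logPair_witness
    (hLc : ∀ j, coeff j L = ite (j = 0) (0 : ℚ) ((-1) ^ (j + 1) / (j : ℚ))) {p : ℕ}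
    (hp : p.Prime) (m : ℕ) :
    ∃ P : MvPolynomial (Fin 2) ℤ, (∀ k < m, coeff k (MvPolynomial.aeval ![L, 1 + X] P) = 0) ∧
      coeff m (MvPolynomial.aeval ![L, 1 + X] P) =
        ((((p - 1).factorial : ℕ) : ℚ) * (-1) ^ (p + 1) / (p : ℚ)) ^ (m / p) := by
  obtain ⟨G, hG⟩ : ∃ G : MvPolynomial (Fin 2) ℤ, ∀ k, coeff k (MvPolynomial.aeval ![L, 1 + X] G) =
      if k < p then 0 else (((p - 1).factorial : ℕ) : ℚ) * (-1) ^ (k + 1) / (k : ℚ) :=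
    ⟨_, coeff_aeval_logPair_gPoly hLc hp⟩
  have hG0 : ∀ k < p, coeff k (MvPolynomial.aeval ![L, 1 + X] G) = 0 := fun k hk => by
    rw [hG k, if_pos hk]
  have hpow := coeff_pow_of_coeff_lt_eq_zero hG0 (m / p)
  have hXv : ∀ k < m % p, coeff k ((X : ℚ⟦X⟧) ^ (m % p)) = 0 := fun k hk => by
    rw [coeff_X_pow, if_neg (by omega)]
  obtain ⟨hprod1, hprod2⟩ := coeff_mul_of_coeff_lt_eq_zero hXv hpow.1
  rw [Nat.mod_add_div' m p] at hprod1 hprod2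
  refine ⟨(MvPolynomial.X 1 - 1) ^ (m % p) * G ^ (m / p), ?_, ?_⟩
  · intro k hk
    rw [map_mul, map_pow, map_pow, aeval_logPair_X_one_sub_one]
    exact hprod1 k hk
  · rw [map_mul, map_pow, map_pow, aeval_logPair_X_one_sub_one, hprod2, hpow.2, hG p,
      if_neg (lt_irrefl p), coeff_X_pow, if_pos rfl, one_mul]

end Witness

/-! ### From coefficients back to jets -/

/-- Converse order transfer: `[zᵏ]Φ(P) = 0 (k < m)` ⇒ `c_n(P) = 0 (n < m)`. [this work] -/
theorem taylorInt_eq_zero_of_coeff_aeval_logPair {L : ℚ⟦X⟧} (hL : (1 + X) * d⁄dX ℚ L = 1)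
    (hL0 : constantCoeff L = 0) (P : MvPolynomial (Fin 2) ℤ) {m : ℕ}
    (h : ∀ k < m, coeff k (MvPolynomial.aeval ![L, 1 + X] P) = 0) :
    ∀ n < m, taylorInt n P = 0 := by
  intro n hn
  have h1 := (coeff_iterate_jetTheta_of_vanish (θ := fun f => (1 + X : ℚ⟦X⟧) * d⁄dX ℚ f)
    (fun _ => rfl) h n hn.le).1 0 (by omega)
  rw [coeff_zero_eq_constantCoeff_apply, ← taylorInt_eq_constantCoeff
    (θ := fun f => (1 + X : ℚ⟦X⟧) * d⁄dX ℚ f) (fun _ => rfl) hL hL0] at h1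
  exact_mod_cast h1

/-! ### Theorem U (sharpness) -/

/-- `|(p−1)!·(−1)^{p+1}/p|_p = p`. [folklore] -/
theorem padicNorm_gPoly_lead (p : ℕ) [hp : Fact p.Prime] :
    padicNorm p ((((p - 1).factorial : ℕ) : ℚ) * (-1) ^ (p + 1) / (p : ℚ)) = p := by
  have hnd : ¬ p ∣ (p - 1).factorial := fun h =>
    absurd (hp.out.dvd_factorial.mp h) (by have := hp.out.pos; omega)
  rw [padicNorm.div, padicNorm.mul, IsAbsoluteValue.abv_pow (padicNorm p), padicNorm.neg,
    padicNorm.one, one_pow, mul_one, padicNorm.padicNorm_p_of_prime,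
    (padicNorm.nat_eq_one_iff _).mpr hnd, one_div, inv_inv]

/-- **Theorem U (sharpness).** For every prime `p` and every `m` there is `P ∈ ℤ[X₀,X₁]` with
`ord₀ P(w,e^w) ≥ m` (`taylorInt n P = 0` for `n < m`) and `|taylorInt m P|_p = p^{−v_p(⌊m/p⌋!)}`
exactly: the bound of `padicNorm_taylorInt_le` is attained. [this work] -/
theorem exists_taylorInt_padicNorm_eq (p : ℕ) [hp : Fact p.Prime] (m : ℕ) :
    ∃ P : MvPolynomial (Fin 2) ℤ, (∀ n < m, taylorInt n P = 0) ∧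
      padicNorm p (taylorInt m P : ℚ) = (p : ℚ) ^ (-(padicValNat p (m / p).factorial : ℤ)) := by
  have hp0 : (p : ℚ) ≠ 0 := by exact_mod_cast hp.out.ne_zero
  have hLc : ∀ j, coeff j (PowerSeries.mk fun j : ℕ => ite (j = 0) (0 : ℚ)
      ((-1) ^ (j + 1) / (j : ℚ))) = ite (j = 0) (0 : ℚ) ((-1) ^ (j + 1) / (j : ℚ)) :=
    fun j => coeff_mk _ _
  obtain ⟨hL, hL0⟩ := logPair_of_coeff hLc
  obtain ⟨P, h1, h2⟩ := exists_coeff_aeval_logPair_witness hLc hp.out m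
  have hn : ∀ n < m, taylorInt n P = 0 := taylorInt_eq_zero_of_coeff_aeval_logPair hL hL0 P h1
  refine ⟨P, hn, ?_⟩
  rw [taylorInt_eq_factorial_mul_coeff (θ := fun f => (1 + X : ℚ⟦X⟧) * d⁄dX ℚ f) (fun _ => rfl)
    hL hL0 P hn, h2, padicNorm.mul, IsAbsoluteValue.abv_pow (padicNorm p), padicNorm_gPoly_lead,
    padicNorm.eq_zpow_of_nonzero (by positivity), ← padicValRat_of_nat,
    padicValNat_factorial_eq_div (p := p) m, ← zpow_natCast, ← zpow_add₀ hp0]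
  congr 1
  push_cast
  ring

/-- **Corollary (no higher power).** For every prime `p` and every `m` there is `P` with
`ord₀ P(w,e^w) ≥ m`, `taylorInt m P ≠ 0` and `p^{v_p(⌊m/p⌋!)+1} ∤ taylorInt m P`. [this work] -/
theorem exists_taylorInt_not_dvd (p : ℕ) [hp : Fact p.Prime] (m : ℕ) :
    ∃ P : MvPolynomial (Fin 2) ℤ, (∀ n < m, taylorInt n P = 0) ∧ taylorInt m P ≠ 0 ∧
      ¬ ((p ^ (padicValNat p (m / p).factorial + 1) : ℕ) : ℤ) ∣ taylorInt m P := by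
  obtain ⟨P, hn, hN⟩ := exists_taylorInt_padicNorm_eq p m
  have hp1 : (1 : ℚ) < p := by exact_mod_cast hp.out.one_lt
  refine ⟨P, hn, fun h0 => ?_, fun hd => ?_⟩
  · rw [h0, Int.cast_zero, padicNorm.zero] at hN
    exact (zpow_pos (by positivity) _).ne hN
  · have := padicNorm.dvd_iff_norm_le.mp hd
    rw [hN, zpow_le_zpow_iff_right₀ hp1] at this
    push_cast at this
    omega

/-- **Corollary (`g_m` is the gcd).** An integer `d` divides `taylorInt m P` for every
`P ∈ ℤ[X₀,X₁]` with `ord₀ P(w,e^w) ≥ m` if and only if `d ∣ g_m = ∏_{p ≤ m} p^{v_p(⌊m/p⌋!)}`.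
[this work] -/
theorem forall_dvd_taylorInt_iff_dvd_padeContent (m : ℕ) (d : ℤ) :
    (∀ P : MvPolynomial (Fin 2) ℤ, (∀ n < m, taylorInt n P = 0) → d ∣ taylorInt m P) ↔
      d ∣ ((∏ p ∈ (Finset.range (m + 1)).filter Nat.Prime,
        p ^ padicValNat p (m / p).factorial : ℕ) : ℤ) := by
  refine ⟨fun hd => ?_, fun hd P hP => hd.trans (padeContent_dvd_taylorInt P hP)⟩
  rw [Int.dvd_natCast, Nat.dvd_iff_prime_pow_dvd_dvd]
  intro p k hpk hk
  have hp : p.Prime := hpk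
  have : Fact p.Prime := ⟨hp⟩
  have hp1 : (1 : ℚ) < p := by exact_mod_cast hp.one_lt
  obtain ⟨P, hn, hN⟩ := exists_taylorInt_padicNorm_eq p m
  -- `p^k ∣ d ∣ taylorInt m P`, so `k ≤ v_p(⌊m/p⌋!)`
  have hkd : ((p ^ k : ℕ) : ℤ) ∣ taylorInt m P := (Int.natCast_dvd.mpr hk).trans (hd P hn)
  have hle := padicNorm.dvd_iff_norm_le.mp hkd
  rw [hN, zpow_le_zpow_iff_right₀ hp1, neg_le_neg_iff, Nat.cast_le] at hle
  rcases Nat.eq_zero_or_pos k with rfl | hk0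
  · simp
  -- `k ≥ 1` forces `p ∣ ⌊m/p⌋!`, hence `p ≤ m`, so `p^{v_p(⌊m/p⌋!)}` is a factor of `g_m`
  have hpm : p ≤ m := by
    have hv : padicValNat p (m / p).factorial ≠ 0 := by omega
    have hdv : p ∣ (m / p).factorial := by
      by_contra hnd
      exact hv (padicValNat.eq_zero_of_not_dvd hnd)
    exact (hp.dvd_factorial.mp hdv).trans (Nat.div_le_self m p)
  exact (pow_dvd_pow p hle).trans (Finset.dvd_prod_of_mem _
    (Finset.mem_filter.mpr ⟨Finset.mem_range.mpr (by omega), hp⟩))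

end Summit.Schanuel.Schanuel.Theorems

end
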